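/-
Copyright: the b2b-balaban T⁴-continuum CRUX team, row NE7b OWNER lineage `t4-ne7b-p1` (gen 137). Project licence.
-/
import Summits.QuantumFields.BalabanUV.T4Continuum.Spine.NE7b.SupBlockLocalResidual

/-!
# THE TWO-SIDED SECOND-ORDER CLASS OF A `Y`-LOCAL BLOCK INPUT'S OUTPUT, ON `Y` — (394)∕(409) §3 IN THE INPUT'S `Σ_Y` LETTERS.
# For a `Y`-local `C²` block potential `U` with the block letters, the two-point upper letter `Λ` on `Y` and the secant lower letter `λ`
# (`2λ ≤ m`, over `N(0,M⁻¹)`): the lower first-order letter of `W = −log Z` ((401), typed with `Σ_i`) and the lower Hessian letter ((403)∕(404),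
# `Σ_i`) take their `Σ_Y` FORMS (replace the target point by the one agreeing with it on `Y` and with the base point off `Y`: `W`, `DW`, `K_D` do
# not notice, (412)∕(413)), so for ALL `ζ, ζ′`, with `K = K_D(ψ₀)`, `w⁺(ζ) = W(ψ₀+ζ) − W(ψ₀) − ⟨b_D,ζ⟩ − ½ζᵀKζ`:
#   `−(λ+½Λ)·Σ_Y(ζ′−ζ)² ≤ w⁺(ζ′) − w⁺(ζ) − Dw⁺(ζ)(ζ′−ζ) ≤ (½Λ+λ)·Σ_Y(ζ′−ζ)²`
# — THE TWO-SIDED CLASS REPRODUCES ON `Y` with the symmetric constant `c⁺ = λ + ½Λ` (tangent form; the input's letters were `Λ∕2` above and the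
# secant `λ∕2·s(1−s)` below): the upper letter IS the input format's `hwup` with `Λ⁺ = Λ + 2λ`, the lower one gives the secant form with
# `λ⁺ = 2λ + Λ` in the successor's file (row NE7b, node U5c; (400)∕(401)∕(404)∕(409)∕(412)∕(413) BY NAME; [folklore])

Cell `pub-balaban`, sub-cell `t4`, spine estimate NE7b (`T4WeightBudget.RelWeightBound`; the cell's OWN estimate — NOT PRINTED in
[Bałaban 1983–89], NOT PROVED).  Crux-route work under `Spine/NE7b/` by the row OWNER (`t4-ne7b-p1` gen 137, file (414)) under FREEZE
(0)'s crux-prover clause, on gen 136's SCOPING-d8 (β1) (this gen's class-closure audit, item (a)); NOTHING of Bałaban's is named as a Lean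
object, valued or asserted; no `T4Continuum/Support` leaf typed; no `def`, no notation (`b_D`, `K_D`, the `Y`-projections WRITTEN OUT); zero
`sorry`.  Imports (BY NAME): the OWNER's (413) `…SupBlockLocalResidual` (`block_quadratic_local`) and through it (412) (`block_Z_local`,
`block_fderiv_W_apply_eq_zero_off`), (409) (`block_quadratic_part_two_sided`), (400) (`block_neg_log_upper_letter_quadratic`), (401)
(`block_neg_log_lower_letter`), (399) (`hasFDerivAt_block_neg_log`), (394) (`quadratic_increment`), (388) (`symmMatrix_isHermitian`).

WHAT IS PROVED ([folklore]; `Z(ψ) = ∫e^{−U(ω+ψ)}dN(0,M⁻¹)`, `ζ^Y = 1_Y·ζ`):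
* §1 `sum_sq_proj_univ`, `sum_sq_proj_on` (`Σ_i(ζ^Y)_i² = Σ_Y(ζ^Y)² = Σ_Yζ²`), **`block_neg_log_lower_letter_local`** ((401) with `Σ_Y`:
  `−log Z(ψ) + DW(ψ)(ψ′−ψ) − λΣ_Y(ψ′−ψ)² ≤ −log Z(ψ′)`), **`block_quadratic_part_two_sided_local`** (`−2λΣ_Yζ² ≤ ζᵀK_D(ψ₀)ζ ≤ ΛΣ_Yζ²`),
  `block_first_order_two_sided_local` (`−½ΛΣ_Yζ² ≤ log Z(ψ₀+ζ) − log Z(ψ₀) + ⟨b_D,ζ⟩ ≤ λΣ_Yζ²`), `block_neg_log_two_sided_at_local`;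
* §2 THE END **`block_residual_second_order_class_local`** (the display, for ALL `ζ, ζ′`); §3 toy.

HONEST (what this is NOT).  The `Σ_Y` bookkeeping of (409)'s class; the output's derivative objects, `κ₁⁺`, `κ₂⁺`, the secant form, the third
Fréchet derivative and a UNIFORM `κ₃⁺` (log-concave concentration) are the successor's files of the class-closure plan; no contraction ((β4)),
no decaying-covariance polymer expansion ((β3′)); scalar skeleton ((A3), NC-NE7b-α UNRULED); nothing of Bałaban's asserted.  BY-NAME EFFECT ON
THE WALL: NONE.  NE7b NOT PRINTED ∕ NOT PROVED; spine PROVED 0∕9; rung (B)+1 — the programme's measures remain FINITE-torus statements; NOT the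
mass gap, NOT Clay.  HONEST DEPENDENCY: continuum YM on T⁴ ⇐ BetaPertH ∧ nine spine estimates (0∕9 proved); BetaPertH ⇐ (D1) ∧ (D4) ∧ CAP+tail;
G-an2-4 gates asym, D1 and NE2∕3∕4.
-/

set_option autoImplicit false
set_option maxSynthPendingDepth 2

noncomputable section

namespace Summit.QuantumFields.BalabanUV.T4Continuum.NE7b.SupBlockLocalClass

open MeasureTheory ProbabilityTheory Finset Real Matrix
open scoped BigOperators
open SupNextHessianMatrix (symmMatrix_isHermitian)
open SupBlockUpperLetter (block_neg_log_upper_letter_quadratic)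
open SupBlockLowerLetter (block_neg_log_lower_letter)
open SupBlockEffectiveActionDerivative (hasFDerivAt_block_neg_log)
open SupBlockResidualRegulated (block_quadratic_part_two_sided)
open SupResidualSecondOrderClass (quadratic_increment)
open SupBlockLocality (block_Z_local block_fderiv_W_apply_eq_zero_off)
open SupBlockLocalResidual (block_quadratic_local)

variable {ι : Type} [Fintype ι] [DecidableEq ι]

/-! ## §1. The letters in `Σ_Y` form -/

omit [Fintype ι] in
/-- `Σ_{x∈Y}(ζ^Y)_x² = Σ_{x∈Y}ζ_x²`. [folklore] -/
theorem sum_sq_proj_on (Y : Finset ι) (ζ : ι → ℝ) :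
    (∑ x ∈ Y, (fun x : ι => if x ∈ Y then ζ x else 0) x ^ 2) = ∑ x ∈ Y, ζ x ^ 2 :=
  Finset.sum_congr rfl fun x hx => by simp only [if_pos hx]

/-- `Σ_i(ζ^Y)_i² = Σ_{x∈Y}ζ_x²`. [folklore] -/
theorem sum_sq_proj_univ (Y : Finset ι) (ζ : ι → ℝ) :
    (∑ i, (fun x : ι => if x ∈ Y then ζ x else 0) i ^ 2) = ∑ x ∈ Y, ζ x ^ 2 := by
  have hi : ∀ i, (fun x : ι => if x ∈ Y then ζ x else 0) i ^ 2 = if i ∈ Y then ζ i ^ 2 else 0 := fun i => by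
    dsimp only; split_ifs <;> simp
  simp_rw [hi]
  rw [Finset.sum_ite_mem, Finset.univ_inter]

section Local

variable {M : Matrix ι ι ℝ} {γop m lam : ℝ} {U : EuclideanSpace ℝ ι → ℝ} {U' : EuclideanSpace ℝ ι → EuclideanSpace ℝ ι →L[ℝ] ℝ}
  {U'' : EuclideanSpace ℝ ι → EuclideanSpace ℝ ι →L[ℝ] EuclideanSpace ℝ ι →L[ℝ] ℝ} {κ₀ κ₁ κ₂ a τ δ θ : ℝ}

/-- **THE LOWER FIRST-ORDER LETTER ON `Y`** — (401) for a `Y`-local input: at EVERY `ψ, ψ′`,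
`−log Z(ψ) + (fderiv ℝ (−log Z) ψ)(ψ′−ψ) − λ·Σ_Y(ψ′−ψ)² ≤ −log Z(ψ′)` (apply (401) towards `ψ + (ψ′−ψ)^Y`, which `Z` and `DW(ψ)` cannot tell
from `ψ′`). [folklore] -/
theorem block_neg_log_lower_letter_local (hM : M.PosDef) (hfl : ∀ z : ι → ℝ, m * ∑ i, z i ^ 2 ≤ z ⬝ᵥ (M *ᵥ z)) (hΓop : (γop • (1 : Matrix ι ι ℝ) - M⁻¹).PosSemidef) (Y :
    Finset ι)
    (hUd : ∀ φ : EuclideanSpace ℝ ι, HasFDerivAt U (U' φ) φ) (hU'c : Continuous U')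
    (hκ₀ : 0 ≤ κ₀) (hκ₁ : 0 ≤ κ₁) (ha : 0 ≤ a) (hτ : 0 < τ) (hδ : 0 < δ) (hθ0 : 0 < θ) (hθ1 : θ < 1)
    (hκθ : (2 * κ₀ * (1 + τ) + 4 * δ) * γop ≤ θ) (hstab : ∀ φ : EuclideanSpace ℝ ι, -(κ₀ * ∑ x ∈ Y, φ x ^ 2) ≤ U φ)
    (hU'b : ∀ φ : EuclideanSpace ℝ ι, ‖U' φ‖ ≤ κ₁ * (a + ∑ x ∈ Y, φ x ^ 2)) (hlam : 0 ≤ lam)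
    (hUsec : ∀ s : ℝ, 0 ≤ s → s ≤ 1 → ∀ a b : EuclideanSpace ℝ ι,
      U ((1 - s) • a + s • b) - lam / 2 * (s * (1 - s)) * ∑ i, (a i - b i) ^ 2 ≤ (1 - s) * U a + s * U b)
    (hm : 2 * lam ≤ m) (hUloc : ∀ φ φ' : EuclideanSpace ℝ ι, (∀ x ∈ Y, φ x = φ' x) → U φ = U φ') (ψ ψ' : EuclideanSpace ℝ ι) :
    -Real.log (∫ ω : EuclideanSpace ℝ ι, exp (-U (ω + ψ)) ∂(multivariateGaussian 0 M⁻¹)) + fderiv ℝ (fun φ : EuclideanSpace ℝ ι => -Real.log (∫ ω : EuclideanSpace ℝ ι, exp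
        (-U (ω + φ)) ∂(multivariateGaussian 0 M⁻¹))) ψ (ψ' - ψ) - lam * (∑ x ∈ Y, (ψ' x - ψ x) ^ 2) ≤
      -Real.log (∫ ω : EuclideanSpace ℝ ι, exp (-U (ω + ψ')) ∂(multivariateGaussian 0 M⁻¹)) := by
  have hΓ : (M⁻¹).PosSemidef := hM.inv.posSemidef
  have h := block_neg_log_lower_letter hM hfl hΓop Y hUd hU'c hκ₀ hκ₁ ha hτ hδ hθ0 hθ1 hκθ hstab hU'b hlam hUsec hm ψ (ψ + (WithLp.toLp 2 (fun x : ι => if x ∈ Y then ψ' x -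
      ψ x else 0) : EuclideanSpace ℝ ι))
  have eZ : (∫ ω : EuclideanSpace ℝ ι, exp (-U (ω + (ψ + (WithLp.toLp 2 (fun x : ι => if x ∈ Y then ψ' x - ψ x else 0) : EuclideanSpace ℝ ι)))) ∂(multivariateGaussian 0
      M⁻¹)) = (∫ ω : EuclideanSpace ℝ ι, exp (-U (ω + ψ')) ∂(multivariateGaussian 0 M⁻¹)) :=
    block_Z_local M⁻¹ Y hUloc _ _ fun x hx => by simp [hx]
  rw [add_sub_cancel_left, eZ] at h
  have e1 : (∑ i, ((ψ + (WithLp.toLp 2 (fun x : ι => if x ∈ Y then ψ' x - ψ x else 0) : EuclideanSpace ℝ ι)) i - ψ i) ^ 2) = (∑ x ∈ Y, (ψ' x - ψ x) ^ 2) := by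
    rw [← sum_sq_proj_univ Y (fun x => ψ' x - ψ x)]
    exact Finset.sum_congr rfl fun i _ => by simp
  have eD : fderiv ℝ (fun φ : EuclideanSpace ℝ ι => -Real.log (∫ ω : EuclideanSpace ℝ ι, exp (-U (ω + φ)) ∂(multivariateGaussian 0 M⁻¹))) ψ (WithLp.toLp 2 (fun x : ι => if
      x ∈ Y then ψ' x - ψ x else 0) : EuclideanSpace ℝ ι) = fderiv ℝ (fun φ : EuclideanSpace ℝ ι => -Real.log (∫ ω : EuclideanSpace ℝ ι, exp (-U (ω + φ))
      ∂(multivariateGaussian 0 M⁻¹))) ψ (ψ' - ψ) := by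
    rw [(hasFDerivAt_block_neg_log hΓ hΓop Y hUd hU'c hκ₀ hκ₁ ha hτ hδ hθ0 hθ1 hκθ hstab hU'b ψ).fderiv]
    have h0 := block_fderiv_W_apply_eq_zero_off hΓ hΓop Y hUd hU'c hκ₀ hκ₁ ha hτ hδ hθ0 hθ1 hκθ hstab hU'b hUloc ψ ((ψ' - ψ) - (WithLp.toLp 2 (fun x : ι => if x ∈ Y then ψ'
        x - ψ x else 0) : EuclideanSpace ℝ ι)) fun x hx => by simp [hx]
    rw [map_sub, sub_eq_zero] at h0
    exact h0.symm
  rw [e1, eD] at h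
  exact h

/-- **THE HESSIAN LETTERS ON `Y`**: `−2λ·Σ_Yζ² ≤ ζᵀK_D(ψ₀)ζ ≤ Λ·Σ_Yζ²` ((409) at `ζ^Y` + (413) `block_quadratic_local`). [folklore] -/
theorem block_quadratic_part_two_sided_local (hM : M.PosDef) (hfl : ∀ z : ι → ℝ, m * ∑ i, z i ^ 2 ≤ z ⬝ᵥ (M *ᵥ z)) (hΓop : (γop • (1 : Matrix ι ι ℝ) - M⁻¹).PosSemidef) (Y :
    Finset ι)
    (hUd : ∀ φ : EuclideanSpace ℝ ι, HasFDerivAt U (U' φ) φ) (hU'd : ∀ φ : EuclideanSpace ℝ ι, HasFDerivAt U' (U'' φ) φ)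
    (hU''c : Continuous U'') (hκ₀ : 0 ≤ κ₀) (hκ₁ : 0 ≤ κ₁) (ha : 0 ≤ a) (hκ₂ : 0 ≤ κ₂) (hτ : 0 < τ) (hδ : 0 < δ) (hθ0 : 0 < θ) (hθ1 : θ < 1)
    (hκθ : (2 * κ₀ * (1 + τ) + 4 * δ) * γop ≤ θ) (hstab : ∀ φ : EuclideanSpace ℝ ι, -(κ₀ * ∑ x ∈ Y, φ x ^ 2) ≤ U φ)
    (hU'b : ∀ φ : EuclideanSpace ℝ ι, ‖U' φ‖ ≤ κ₁ * (a + ∑ x ∈ Y, φ x ^ 2)) (hU''b : ∀ φ : EuclideanSpace ℝ ι, ‖U'' φ‖ ≤ κ₂) {Λ : ℝ}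
    (hwup : ∀ φ φ' : EuclideanSpace ℝ ι, U φ' ≤ U φ + U' φ (φ' - φ) + Λ / 2 * ∑ x ∈ Y, (φ' x - φ x) ^ 2) (hlam : 0 ≤ lam)
    (hUsec : ∀ s : ℝ, 0 ≤ s → s ≤ 1 → ∀ a b : EuclideanSpace ℝ ι,
      U ((1 - s) • a + s • b) - lam / 2 * (s * (1 - s)) * ∑ i, (a i - b i) ^ 2 ≤ (1 - s) * U a + s * U b)
    (hm : 2 * lam ≤ m) (hUloc : ∀ φ φ' : EuclideanSpace ℝ ι, (∀ x ∈ Y, φ x = φ' x) → U φ = U φ') (ψ₀ ζ : EuclideanSpace ℝ ι) :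
    -(2 * lam * (∑ x ∈ Y, ζ x ^ 2)) ≤ ((WithLp.ofLp ζ) ⬝ᵥ (Matrix.of fun x y : ι => (((∫ ω : EuclideanSpace ℝ ι, exp (-U (ω + ψ₀)) ∂(multivariateGaussian 0 M⁻¹))⁻¹ • (∫ ω :
        EuclideanSpace ℝ ι, exp (-U (ω + ψ₀)) • (U'' (ω + ψ₀) - (U' (ω + ψ₀)).smulRight (U' (ω + ψ₀))) ∂(multivariateGaussian 0 M⁻¹)) + (((∫ ω : EuclideanSpace ℝ ι, exp (-U
        (ω + ψ₀)) ∂(multivariateGaussian 0 M⁻¹)) ^ 2)⁻¹ • ∫ ω : EuclideanSpace ℝ ι, exp (-U (ω + ψ₀)) • U' (ω + ψ₀) ∂(multivariateGaussian 0 M⁻¹)).smulRight (∫ ω :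
        EuclideanSpace ℝ ι, exp (-U (ω + ψ₀)) • U' (ω + ψ₀) ∂(multivariateGaussian 0 M⁻¹))) (EuclideanSpace.single x (1 : ℝ)) (EuclideanSpace.single y (1 : ℝ)) + ((∫ ω :
        EuclideanSpace ℝ ι, exp (-U (ω + ψ₀)) ∂(multivariateGaussian 0 M⁻¹))⁻¹ • (∫ ω : EuclideanSpace ℝ ι, exp (-U (ω + ψ₀)) • (U'' (ω + ψ₀) - (U' (ω + ψ₀)).smulRight (U'
        (ω + ψ₀))) ∂(multivariateGaussian 0 M⁻¹)) + (((∫ ω : EuclideanSpace ℝ ι, exp (-U (ω + ψ₀)) ∂(multivariateGaussian 0 M⁻¹)) ^ 2)⁻¹ • ∫ ω : EuclideanSpace ℝ ι, exp (-U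
        (ω + ψ₀)) • U' (ω + ψ₀) ∂(multivariateGaussian 0 M⁻¹)).smulRight (∫ ω : EuclideanSpace ℝ ι, exp (-U (ω + ψ₀)) • U' (ω + ψ₀) ∂(multivariateGaussian 0 M⁻¹)))
        (EuclideanSpace.single y (1 : ℝ)) (EuclideanSpace.single x (1 : ℝ))) / 2) *ᵥ (WithLp.ofLp ζ)) ∧
      ((WithLp.ofLp ζ) ⬝ᵥ (Matrix.of fun x y : ι => (((∫ ω : EuclideanSpace ℝ ι, exp (-U (ω + ψ₀)) ∂(multivariateGaussian 0 M⁻¹))⁻¹ • (∫ ω : EuclideanSpace ℝ ι, exp (-U (ω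
          + ψ₀)) • (U'' (ω + ψ₀) - (U' (ω + ψ₀)).smulRight (U' (ω + ψ₀))) ∂(multivariateGaussian 0 M⁻¹)) + (((∫ ω : EuclideanSpace ℝ ι, exp (-U (ω + ψ₀))
          ∂(multivariateGaussian 0 M⁻¹)) ^ 2)⁻¹ • ∫ ω : EuclideanSpace ℝ ι, exp (-U (ω + ψ₀)) • U' (ω + ψ₀) ∂(multivariateGaussian 0 M⁻¹)).smulRight (∫ ω : EuclideanSpace ℝ
          ι, exp (-U (ω + ψ₀)) • U' (ω + ψ₀) ∂(multivariateGaussian 0 M⁻¹))) (EuclideanSpace.single x (1 : ℝ)) (EuclideanSpace.single y (1 : ℝ)) + ((∫ ω : EuclideanSpace ℝ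
          ι, exp (-U (ω + ψ₀)) ∂(multivariateGaussian 0 M⁻¹))⁻¹ • (∫ ω : EuclideanSpace ℝ ι, exp (-U (ω + ψ₀)) • (U'' (ω + ψ₀) - (U' (ω + ψ₀)).smulRight (U' (ω + ψ₀)))
          ∂(multivariateGaussian 0 M⁻¹)) + (((∫ ω : EuclideanSpace ℝ ι, exp (-U (ω + ψ₀)) ∂(multivariateGaussian 0 M⁻¹)) ^ 2)⁻¹ • ∫ ω : EuclideanSpace ℝ ι, exp (-U (ω +
          ψ₀)) • U' (ω + ψ₀) ∂(multivariateGaussian 0 M⁻¹)).smulRight (∫ ω : EuclideanSpace ℝ ι, exp (-U (ω + ψ₀)) • U' (ω + ψ₀) ∂(multivariateGaussian 0 M⁻¹)))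
          (EuclideanSpace.single y (1 : ℝ)) (EuclideanSpace.single x (1 : ℝ))) / 2) *ᵥ (WithLp.ofLp ζ)) ≤ Λ * (∑ x ∈ Y, ζ x ^ 2) := by
  rw [block_quadratic_local hM hΓop Y hUd hU'd hU''c hκ₀ hκ₁ ha hκ₂ hτ hδ hθ0 hθ1 hκθ hstab hU'b hU''b hUloc ψ₀ ζ]
  have h := block_quadratic_part_two_sided hM hfl hΓop Y hUd hU'd hU''c hκ₀ hκ₁ ha hκ₂ hτ hδ hθ0 hθ1 hκθ hstab hU'b hU''b hwup hlam hUsec hm ψ₀ (WithLp.toLp 2 (fun x : ι =>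
      if x ∈ Y then ζ x else 0) : EuclideanSpace ℝ ι)
  have e1 : (∑ i, ((WithLp.toLp 2 (fun x : ι => if x ∈ Y then ζ x else 0) : EuclideanSpace ℝ ι)) i ^ 2) = (∑ x ∈ Y, ζ x ^ 2) := sum_sq_proj_univ Y (fun x => ζ x)
  have e2 : (∑ x ∈ Y, ((WithLp.toLp 2 (fun x : ι => if x ∈ Y then ζ x else 0) : EuclideanSpace ℝ ι)) x ^ 2) = (∑ x ∈ Y, ζ x ^ 2) := sum_sq_proj_on Y (fun x => ζ x)
  rw [e1, e2] at h
  exact h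

/-- **The first-order remainder on `Y`, two-sided**: `−½Λ·Σ_Yζ² ≤ log Z(ψ₀+ζ) − log Z(ψ₀) + ⟨b_D(ψ₀),ζ⟩ ≤ λ·Σ_Yζ²`. [folklore] -/
theorem block_first_order_two_sided_local (hM : M.PosDef) (hfl : ∀ z : ι → ℝ, m * ∑ i, z i ^ 2 ≤ z ⬝ᵥ (M *ᵥ z)) (hΓop : (γop • (1 : Matrix ι ι ℝ) - M⁻¹).PosSemidef) (Y :
    Finset ι)
    (hUd : ∀ φ : EuclideanSpace ℝ ι, HasFDerivAt U (U' φ) φ) (hU'c : Continuous U')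
    (hκ₀ : 0 ≤ κ₀) (hκ₁ : 0 ≤ κ₁) (ha : 0 ≤ a) (hτ : 0 < τ) (hδ : 0 < δ) (hθ0 : 0 < θ) (hθ1 : θ < 1)
    (hκθ : (2 * κ₀ * (1 + τ) + 4 * δ) * γop ≤ θ) (hstab : ∀ φ : EuclideanSpace ℝ ι, -(κ₀ * ∑ x ∈ Y, φ x ^ 2) ≤ U φ)
    (hU'b : ∀ φ : EuclideanSpace ℝ ι, ‖U' φ‖ ≤ κ₁ * (a + ∑ x ∈ Y, φ x ^ 2)) {Λ : ℝ}
    (hwup : ∀ φ φ' : EuclideanSpace ℝ ι, U φ' ≤ U φ + U' φ (φ' - φ) + Λ / 2 * ∑ x ∈ Y, (φ' x - φ x) ^ 2) (hlam : 0 ≤ lam)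
    (hUsec : ∀ s : ℝ, 0 ≤ s → s ≤ 1 → ∀ a b : EuclideanSpace ℝ ι,
      U ((1 - s) • a + s • b) - lam / 2 * (s * (1 - s)) * ∑ i, (a i - b i) ^ 2 ≤ (1 - s) * U a + s * U b)
    (hm : 2 * lam ≤ m) (hUloc : ∀ φ φ' : EuclideanSpace ℝ ι, (∀ x ∈ Y, φ x = φ' x) → U φ = U φ') (ψ₀ ζ : EuclideanSpace ℝ ι) :
    -(Λ / 2 * (∑ x ∈ Y, ζ x ^ 2)) ≤ Real.log (∫ ω : EuclideanSpace ℝ ι, exp (-U (ω + (ψ₀ + ζ))) ∂(multivariateGaussian 0 M⁻¹)) - Real.log (∫ ω : EuclideanSpace ℝ ι, exp (-U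
        (ω + ψ₀)) ∂(multivariateGaussian 0 M⁻¹)) + ((fun x : ι => ((∫ ω : EuclideanSpace ℝ ι, exp (-U (ω + ψ₀)) ∂(multivariateGaussian 0 M⁻¹))⁻¹ • ∫ ω : EuclideanSpace ℝ ι,
        exp (-U (ω + ψ₀)) • U' (ω + ψ₀) ∂(multivariateGaussian 0 M⁻¹)) (EuclideanSpace.single x (1 : ℝ))) ⬝ᵥ (WithLp.ofLp ζ)) ∧
      Real.log (∫ ω : EuclideanSpace ℝ ι, exp (-U (ω + (ψ₀ + ζ))) ∂(multivariateGaussian 0 M⁻¹)) - Real.log (∫ ω : EuclideanSpace ℝ ι, exp (-U (ω + ψ₀))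
          ∂(multivariateGaussian 0 M⁻¹)) + ((fun x : ι => ((∫ ω : EuclideanSpace ℝ ι, exp (-U (ω + ψ₀)) ∂(multivariateGaussian 0 M⁻¹))⁻¹ • ∫ ω : EuclideanSpace ℝ ι, exp (-U
          (ω + ψ₀)) • U' (ω + ψ₀) ∂(multivariateGaussian 0 M⁻¹)) (EuclideanSpace.single x (1 : ℝ))) ⬝ᵥ (WithLp.ofLp ζ)) ≤ lam * (∑ x ∈ Y, ζ x ^ 2) := by
  have hΓ : (M⁻¹).PosSemidef := hM.inv.posSemidef
  have hup := block_neg_log_upper_letter_quadratic hΓ hΓop Y hUd hU'c hκ₀ hκ₁ ha hτ hδ hθ0 hθ1 hκθ hstab hU'b hwup ψ₀ (ψ₀ + ζ)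
  have hlo := block_neg_log_lower_letter_local hM hfl hΓop Y hUd hU'c hκ₀ hκ₁ ha hτ hδ hθ0 hθ1 hκθ hstab hU'b hlam hUsec hm hUloc ψ₀ (ψ₀ + ζ)
  have hb : fderiv ℝ (fun φ : EuclideanSpace ℝ ι => -Real.log (∫ ω : EuclideanSpace ℝ ι, exp (-U (ω + φ)) ∂(multivariateGaussian 0 M⁻¹))) ψ₀ ζ = ((fun x : ι => ((∫ ω :
      EuclideanSpace ℝ ι, exp (-U (ω + ψ₀)) ∂(multivariateGaussian 0 M⁻¹))⁻¹ • ∫ ω : EuclideanSpace ℝ ι, exp (-U (ω + ψ₀)) • U' (ω + ψ₀) ∂(multivariateGaussian 0 M⁻¹))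
      (EuclideanSpace.single x (1 : ℝ))) ⬝ᵥ (WithLp.ofLp ζ)) := by
    rw [(hasFDerivAt_block_neg_log hΓ hΓop Y hUd hU'c hκ₀ hκ₁ ha hτ hδ hθ0 hθ1 hκθ hstab hU'b ψ₀).fderiv]
    exact SupNextHessianMatrix.clm₁_apply_eq_dot _ ζ
  simp only [PiLp.add_apply, add_sub_cancel_left] at hup hlo
  rw [hb] at hup hlo
  constructor
  · linarith
  · linarith

/-- **The two-sided letters of `W` at the base point `ψ₀ + ζ` towards `ψ₀ + ζ′`, on `Y`.** [folklore] -/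
theorem block_neg_log_two_sided_at_local (hM : M.PosDef) (hfl : ∀ z : ι → ℝ, m * ∑ i, z i ^ 2 ≤ z ⬝ᵥ (M *ᵥ z)) (hΓop : (γop • (1 : Matrix ι ι ℝ) - M⁻¹).PosSemidef) (Y :
    Finset ι)
    (hUd : ∀ φ : EuclideanSpace ℝ ι, HasFDerivAt U (U' φ) φ) (hU'c : Continuous U')
    (hκ₀ : 0 ≤ κ₀) (hκ₁ : 0 ≤ κ₁) (ha : 0 ≤ a) (hτ : 0 < τ) (hδ : 0 < δ) (hθ0 : 0 < θ) (hθ1 : θ < 1)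
    (hκθ : (2 * κ₀ * (1 + τ) + 4 * δ) * γop ≤ θ) (hstab : ∀ φ : EuclideanSpace ℝ ι, -(κ₀ * ∑ x ∈ Y, φ x ^ 2) ≤ U φ)
    (hU'b : ∀ φ : EuclideanSpace ℝ ι, ‖U' φ‖ ≤ κ₁ * (a + ∑ x ∈ Y, φ x ^ 2)) {Λ : ℝ}
    (hwup : ∀ φ φ' : EuclideanSpace ℝ ι, U φ' ≤ U φ + U' φ (φ' - φ) + Λ / 2 * ∑ x ∈ Y, (φ' x - φ x) ^ 2) (hlam : 0 ≤ lam)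
    (hUsec : ∀ s : ℝ, 0 ≤ s → s ≤ 1 → ∀ a b : EuclideanSpace ℝ ι,
      U ((1 - s) • a + s • b) - lam / 2 * (s * (1 - s)) * ∑ i, (a i - b i) ^ 2 ≤ (1 - s) * U a + s * U b)
    (hm : 2 * lam ≤ m) (hUloc : ∀ φ φ' : EuclideanSpace ℝ ι, (∀ x ∈ Y, φ x = φ' x) → U φ = U φ') (ψ₀ ζ ζ' : EuclideanSpace ℝ ι) :
    -Real.log (∫ ω : EuclideanSpace ℝ ι, exp (-U (ω + (ψ₀ + ζ'))) ∂(multivariateGaussian 0 M⁻¹)) ≤ -Real.log (∫ ω : EuclideanSpace ℝ ι, exp (-U (ω + (ψ₀ + ζ)))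
        ∂(multivariateGaussian 0 M⁻¹)) + fderiv ℝ (fun φ : EuclideanSpace ℝ ι => -Real.log (∫ ω : EuclideanSpace ℝ ι, exp (-U (ω + φ)) ∂(multivariateGaussian 0 M⁻¹))) (ψ₀ +
        ζ) (ζ' - ζ) + Λ / 2 * (∑ x ∈ Y, (ζ' x - ζ x) ^ 2) ∧
      -Real.log (∫ ω : EuclideanSpace ℝ ι, exp (-U (ω + (ψ₀ + ζ))) ∂(multivariateGaussian 0 M⁻¹)) + fderiv ℝ (fun φ : EuclideanSpace ℝ ι => -Real.log (∫ ω : EuclideanSpace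
          ℝ ι, exp (-U (ω + φ)) ∂(multivariateGaussian 0 M⁻¹))) (ψ₀ + ζ) (ζ' - ζ) - lam * (∑ x ∈ Y, (ζ' x - ζ x) ^ 2) ≤ -Real.log (∫ ω : EuclideanSpace ℝ ι, exp (-U (ω +
          (ψ₀ + ζ'))) ∂(multivariateGaussian 0 M⁻¹)) := by
  have hΓ : (M⁻¹).PosSemidef := hM.inv.posSemidef
  have hup := block_neg_log_upper_letter_quadratic hΓ hΓop Y hUd hU'c hκ₀ hκ₁ ha hτ hδ hθ0 hθ1 hκθ hstab hU'b hwup (ψ₀ + ζ) (ψ₀ + ζ')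
  have hlo := block_neg_log_lower_letter_local hM hfl hΓop Y hUd hU'c hκ₀ hκ₁ ha hτ hδ hθ0 hθ1 hκθ hstab hU'b hlam hUsec hm hUloc (ψ₀ + ζ) (ψ₀ + ζ')
  simp only [PiLp.add_apply, add_sub_add_left_eq_sub] at hup hlo
  exact ⟨hup, hlo⟩

/-! ## §2. THE END: the class reproduces on `Y` -/

/-- **THE BLOCK RESIDUAL IS IN THE TWO-SIDED SECOND-ORDER CLASS ON `Y`.**  For a `Y`-local input under §1's hypotheses, for ALL `ζ, ζ′`:
writing `W = −log Z`, `K = K_D(ψ₀)` and `w⁺(ζ) = W(ψ₀+ζ) − W(ψ₀) − ⟨b_D,ζ⟩ − ½ζᵀKζ`, the increment `w⁺(ζ′) − w⁺(ζ) − Dw⁺(ζ)(ζ′−ζ)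
= [W(ψ₀+ζ′) − W(ψ₀+ζ) − ½(ζ′ᵀKζ′ − ζᵀKζ)] − [DW(ψ₀+ζ)(ζ′−ζ) − ζᵀK(ζ′−ζ)]` satisfies
`−(λ+½Λ)·Σ_Y(ζ′−ζ)² ≤ · ≤ (½Λ+λ)·Σ_Y(ζ′−ζ)²`. [folklore] -/
theorem block_residual_second_order_class_local (hM : M.PosDef) (hfl : ∀ z : ι → ℝ, m * ∑ i, z i ^ 2 ≤ z ⬝ᵥ (M *ᵥ z)) (hΓop : (γop • (1 : Matrix ι ι ℝ) - M⁻¹).PosSemidef)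
    (Y : Finset ι)
    (hUd : ∀ φ : EuclideanSpace ℝ ι, HasFDerivAt U (U' φ) φ) (hU'd : ∀ φ : EuclideanSpace ℝ ι, HasFDerivAt U' (U'' φ) φ)
    (hU''c : Continuous U'') (hκ₀ : 0 ≤ κ₀) (hκ₁ : 0 ≤ κ₁) (ha : 0 ≤ a) (hκ₂ : 0 ≤ κ₂) (hτ : 0 < τ) (hδ : 0 < δ) (hθ0 : 0 < θ) (hθ1 : θ < 1)
    (hκθ : (2 * κ₀ * (1 + τ) + 4 * δ) * γop ≤ θ) (hstab : ∀ φ : EuclideanSpace ℝ ι, -(κ₀ * ∑ x ∈ Y, φ x ^ 2) ≤ U φ)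
    (hU'b : ∀ φ : EuclideanSpace ℝ ι, ‖U' φ‖ ≤ κ₁ * (a + ∑ x ∈ Y, φ x ^ 2)) (hU''b : ∀ φ : EuclideanSpace ℝ ι, ‖U'' φ‖ ≤ κ₂) {Λ : ℝ}
    (hwup : ∀ φ φ' : EuclideanSpace ℝ ι, U φ' ≤ U φ + U' φ (φ' - φ) + Λ / 2 * ∑ x ∈ Y, (φ' x - φ x) ^ 2) (hlam : 0 ≤ lam)
    (hUsec : ∀ s : ℝ, 0 ≤ s → s ≤ 1 → ∀ a b : EuclideanSpace ℝ ι,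
      U ((1 - s) • a + s • b) - lam / 2 * (s * (1 - s)) * ∑ i, (a i - b i) ^ 2 ≤ (1 - s) * U a + s * U b)
    (hm : 2 * lam ≤ m) (hUloc : ∀ φ φ' : EuclideanSpace ℝ ι, (∀ x ∈ Y, φ x = φ' x) → U φ = U φ') (ψ₀ ζ ζ' : EuclideanSpace ℝ ι) :
    -((lam + Λ / 2) * (∑ x ∈ Y, (ζ' x - ζ x) ^ 2)) ≤ (-Real.log (∫ ω : EuclideanSpace ℝ ι, exp (-U (ω + (ψ₀ + ζ'))) ∂(multivariateGaussian 0 M⁻¹)) - -Real.log (∫ ω :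
        EuclideanSpace ℝ ι, exp (-U (ω + (ψ₀ + ζ))) ∂(multivariateGaussian 0 M⁻¹)) - (((WithLp.ofLp ζ') ⬝ᵥ (Matrix.of fun x y : ι => (((∫ ω : EuclideanSpace ℝ ι, exp (-U (ω
        + ψ₀)) ∂(multivariateGaussian 0 M⁻¹))⁻¹ • (∫ ω : EuclideanSpace ℝ ι, exp (-U (ω + ψ₀)) • (U'' (ω + ψ₀) - (U' (ω + ψ₀)).smulRight (U' (ω + ψ₀)))
        ∂(multivariateGaussian 0 M⁻¹)) + (((∫ ω : EuclideanSpace ℝ ι, exp (-U (ω + ψ₀)) ∂(multivariateGaussian 0 M⁻¹)) ^ 2)⁻¹ • ∫ ω : EuclideanSpace ℝ ι, exp (-U (ω + ψ₀))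
        • U' (ω + ψ₀) ∂(multivariateGaussian 0 M⁻¹)).smulRight (∫ ω : EuclideanSpace ℝ ι, exp (-U (ω + ψ₀)) • U' (ω + ψ₀) ∂(multivariateGaussian 0 M⁻¹)))
        (EuclideanSpace.single x (1 : ℝ)) (EuclideanSpace.single y (1 : ℝ)) + ((∫ ω : EuclideanSpace ℝ ι, exp (-U (ω + ψ₀)) ∂(multivariateGaussian 0 M⁻¹))⁻¹ • (∫ ω :
        EuclideanSpace ℝ ι, exp (-U (ω + ψ₀)) • (U'' (ω + ψ₀) - (U' (ω + ψ₀)).smulRight (U' (ω + ψ₀))) ∂(multivariateGaussian 0 M⁻¹)) + (((∫ ω : EuclideanSpace ℝ ι, exp (-U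
        (ω + ψ₀)) ∂(multivariateGaussian 0 M⁻¹)) ^ 2)⁻¹ • ∫ ω : EuclideanSpace ℝ ι, exp (-U (ω + ψ₀)) • U' (ω + ψ₀) ∂(multivariateGaussian 0 M⁻¹)).smulRight (∫ ω :
        EuclideanSpace ℝ ι, exp (-U (ω + ψ₀)) • U' (ω + ψ₀) ∂(multivariateGaussian 0 M⁻¹))) (EuclideanSpace.single y (1 : ℝ)) (EuclideanSpace.single x (1 : ℝ))) / 2) *ᵥ
        (WithLp.ofLp ζ')) - ((WithLp.ofLp ζ) ⬝ᵥ (Matrix.of fun x y : ι => (((∫ ω : EuclideanSpace ℝ ι, exp (-U (ω + ψ₀)) ∂(multivariateGaussian 0 M⁻¹))⁻¹ • (∫ ω :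
        EuclideanSpace ℝ ι, exp (-U (ω + ψ₀)) • (U'' (ω + ψ₀) - (U' (ω + ψ₀)).smulRight (U' (ω + ψ₀))) ∂(multivariateGaussian 0 M⁻¹)) + (((∫ ω : EuclideanSpace ℝ ι, exp (-U
        (ω + ψ₀)) ∂(multivariateGaussian 0 M⁻¹)) ^ 2)⁻¹ • ∫ ω : EuclideanSpace ℝ ι, exp (-U (ω + ψ₀)) • U' (ω + ψ₀) ∂(multivariateGaussian 0 M⁻¹)).smulRight (∫ ω :
        EuclideanSpace ℝ ι, exp (-U (ω + ψ₀)) • U' (ω + ψ₀) ∂(multivariateGaussian 0 M⁻¹))) (EuclideanSpace.single x (1 : ℝ)) (EuclideanSpace.single y (1 : ℝ)) + ((∫ ω :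
        EuclideanSpace ℝ ι, exp (-U (ω + ψ₀)) ∂(multivariateGaussian 0 M⁻¹))⁻¹ • (∫ ω : EuclideanSpace ℝ ι, exp (-U (ω + ψ₀)) • (U'' (ω + ψ₀) - (U' (ω + ψ₀)).smulRight (U'
        (ω + ψ₀))) ∂(multivariateGaussian 0 M⁻¹)) + (((∫ ω : EuclideanSpace ℝ ι, exp (-U (ω + ψ₀)) ∂(multivariateGaussian 0 M⁻¹)) ^ 2)⁻¹ • ∫ ω : EuclideanSpace ℝ ι, exp (-U
        (ω + ψ₀)) • U' (ω + ψ₀) ∂(multivariateGaussian 0 M⁻¹)).smulRight (∫ ω : EuclideanSpace ℝ ι, exp (-U (ω + ψ₀)) • U' (ω + ψ₀) ∂(multivariateGaussian 0 M⁻¹)))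
        (EuclideanSpace.single y (1 : ℝ)) (EuclideanSpace.single x (1 : ℝ))) / 2) *ᵥ (WithLp.ofLp ζ))) / 2) - (fderiv ℝ (fun φ : EuclideanSpace ℝ ι => -Real.log (∫ ω :
        EuclideanSpace ℝ ι, exp (-U (ω + φ)) ∂(multivariateGaussian 0 M⁻¹))) (ψ₀ + ζ) (ζ' - ζ) - ((WithLp.ofLp ζ) ⬝ᵥ (Matrix.of fun x y : ι => (((∫ ω : EuclideanSpace ℝ ι,
        exp (-U (ω + ψ₀)) ∂(multivariateGaussian 0 M⁻¹))⁻¹ • (∫ ω : EuclideanSpace ℝ ι, exp (-U (ω + ψ₀)) • (U'' (ω + ψ₀) - (U' (ω + ψ₀)).smulRight (U' (ω + ψ₀)))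
        ∂(multivariateGaussian 0 M⁻¹)) + (((∫ ω : EuclideanSpace ℝ ι, exp (-U (ω + ψ₀)) ∂(multivariateGaussian 0 M⁻¹)) ^ 2)⁻¹ • ∫ ω : EuclideanSpace ℝ ι, exp (-U (ω + ψ₀))
        • U' (ω + ψ₀) ∂(multivariateGaussian 0 M⁻¹)).smulRight (∫ ω : EuclideanSpace ℝ ι, exp (-U (ω + ψ₀)) • U' (ω + ψ₀) ∂(multivariateGaussian 0 M⁻¹)))
        (EuclideanSpace.single x (1 : ℝ)) (EuclideanSpace.single y (1 : ℝ)) + ((∫ ω : EuclideanSpace ℝ ι, exp (-U (ω + ψ₀)) ∂(multivariateGaussian 0 M⁻¹))⁻¹ • (∫ ω :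
        EuclideanSpace ℝ ι, exp (-U (ω + ψ₀)) • (U'' (ω + ψ₀) - (U' (ω + ψ₀)).smulRight (U' (ω + ψ₀))) ∂(multivariateGaussian 0 M⁻¹)) + (((∫ ω : EuclideanSpace ℝ ι, exp (-U
        (ω + ψ₀)) ∂(multivariateGaussian 0 M⁻¹)) ^ 2)⁻¹ • ∫ ω : EuclideanSpace ℝ ι, exp (-U (ω + ψ₀)) • U' (ω + ψ₀) ∂(multivariateGaussian 0 M⁻¹)).smulRight (∫ ω :
        EuclideanSpace ℝ ι, exp (-U (ω + ψ₀)) • U' (ω + ψ₀) ∂(multivariateGaussian 0 M⁻¹))) (EuclideanSpace.single y (1 : ℝ)) (EuclideanSpace.single x (1 : ℝ))) / 2) *ᵥ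
        (WithLp.ofLp (ζ' - ζ)))) ∧
      (-Real.log (∫ ω : EuclideanSpace ℝ ι, exp (-U (ω + (ψ₀ + ζ'))) ∂(multivariateGaussian 0 M⁻¹)) - -Real.log (∫ ω : EuclideanSpace ℝ ι, exp (-U (ω + (ψ₀ + ζ)))
          ∂(multivariateGaussian 0 M⁻¹)) - (((WithLp.ofLp ζ') ⬝ᵥ (Matrix.of fun x y : ι => (((∫ ω : EuclideanSpace ℝ ι, exp (-U (ω + ψ₀)) ∂(multivariateGaussian 0 M⁻¹))⁻¹ •
          (∫ ω : EuclideanSpace ℝ ι, exp (-U (ω + ψ₀)) • (U'' (ω + ψ₀) - (U' (ω + ψ₀)).smulRight (U' (ω + ψ₀))) ∂(multivariateGaussian 0 M⁻¹)) + (((∫ ω : EuclideanSpace ℝ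
          ι, exp (-U (ω + ψ₀)) ∂(multivariateGaussian 0 M⁻¹)) ^ 2)⁻¹ • ∫ ω : EuclideanSpace ℝ ι, exp (-U (ω + ψ₀)) • U' (ω + ψ₀) ∂(multivariateGaussian 0 M⁻¹)).smulRight (∫
          ω : EuclideanSpace ℝ ι, exp (-U (ω + ψ₀)) • U' (ω + ψ₀) ∂(multivariateGaussian 0 M⁻¹))) (EuclideanSpace.single x (1 : ℝ)) (EuclideanSpace.single y (1 : ℝ)) + ((∫
          ω : EuclideanSpace ℝ ι, exp (-U (ω + ψ₀)) ∂(multivariateGaussian 0 M⁻¹))⁻¹ • (∫ ω : EuclideanSpace ℝ ι, exp (-U (ω + ψ₀)) • (U'' (ω + ψ₀) - (U' (ω +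
          ψ₀)).smulRight (U' (ω + ψ₀))) ∂(multivariateGaussian 0 M⁻¹)) + (((∫ ω : EuclideanSpace ℝ ι, exp (-U (ω + ψ₀)) ∂(multivariateGaussian 0 M⁻¹)) ^ 2)⁻¹ • ∫ ω :
          EuclideanSpace ℝ ι, exp (-U (ω + ψ₀)) • U' (ω + ψ₀) ∂(multivariateGaussian 0 M⁻¹)).smulRight (∫ ω : EuclideanSpace ℝ ι, exp (-U (ω + ψ₀)) • U' (ω + ψ₀)
          ∂(multivariateGaussian 0 M⁻¹))) (EuclideanSpace.single y (1 : ℝ)) (EuclideanSpace.single x (1 : ℝ))) / 2) *ᵥ (WithLp.ofLp ζ')) - ((WithLp.ofLp ζ) ⬝ᵥ (Matrix.of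
          fun x y : ι => (((∫ ω : EuclideanSpace ℝ ι, exp (-U (ω + ψ₀)) ∂(multivariateGaussian 0 M⁻¹))⁻¹ • (∫ ω : EuclideanSpace ℝ ι, exp (-U (ω + ψ₀)) • (U'' (ω + ψ₀) -
          (U' (ω + ψ₀)).smulRight (U' (ω + ψ₀))) ∂(multivariateGaussian 0 M⁻¹)) + (((∫ ω : EuclideanSpace ℝ ι, exp (-U (ω + ψ₀)) ∂(multivariateGaussian 0 M⁻¹)) ^ 2)⁻¹ • ∫ ω
          : EuclideanSpace ℝ ι, exp (-U (ω + ψ₀)) • U' (ω + ψ₀) ∂(multivariateGaussian 0 M⁻¹)).smulRight (∫ ω : EuclideanSpace ℝ ι, exp (-U (ω + ψ₀)) • U' (ω + ψ₀)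
          ∂(multivariateGaussian 0 M⁻¹))) (EuclideanSpace.single x (1 : ℝ)) (EuclideanSpace.single y (1 : ℝ)) + ((∫ ω : EuclideanSpace ℝ ι, exp (-U (ω + ψ₀))
          ∂(multivariateGaussian 0 M⁻¹))⁻¹ • (∫ ω : EuclideanSpace ℝ ι, exp (-U (ω + ψ₀)) • (U'' (ω + ψ₀) - (U' (ω + ψ₀)).smulRight (U' (ω + ψ₀))) ∂(multivariateGaussian 0
          M⁻¹)) + (((∫ ω : EuclideanSpace ℝ ι, exp (-U (ω + ψ₀)) ∂(multivariateGaussian 0 M⁻¹)) ^ 2)⁻¹ • ∫ ω : EuclideanSpace ℝ ι, exp (-U (ω + ψ₀)) • U' (ω + ψ₀)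
          ∂(multivariateGaussian 0 M⁻¹)).smulRight (∫ ω : EuclideanSpace ℝ ι, exp (-U (ω + ψ₀)) • U' (ω + ψ₀) ∂(multivariateGaussian 0 M⁻¹))) (EuclideanSpace.single y (1 :
          ℝ)) (EuclideanSpace.single x (1 : ℝ))) / 2) *ᵥ (WithLp.ofLp ζ))) / 2) - (fderiv ℝ (fun φ : EuclideanSpace ℝ ι => -Real.log (∫ ω : EuclideanSpace ℝ ι, exp (-U (ω +
          φ)) ∂(multivariateGaussian 0 M⁻¹))) (ψ₀ + ζ) (ζ' - ζ) - ((WithLp.ofLp ζ) ⬝ᵥ (Matrix.of fun x y : ι => (((∫ ω : EuclideanSpace ℝ ι, exp (-U (ω + ψ₀))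
          ∂(multivariateGaussian 0 M⁻¹))⁻¹ • (∫ ω : EuclideanSpace ℝ ι, exp (-U (ω + ψ₀)) • (U'' (ω + ψ₀) - (U' (ω + ψ₀)).smulRight (U' (ω + ψ₀))) ∂(multivariateGaussian 0
          M⁻¹)) + (((∫ ω : EuclideanSpace ℝ ι, exp (-U (ω + ψ₀)) ∂(multivariateGaussian 0 M⁻¹)) ^ 2)⁻¹ • ∫ ω : EuclideanSpace ℝ ι, exp (-U (ω + ψ₀)) • U' (ω + ψ₀)
          ∂(multivariateGaussian 0 M⁻¹)).smulRight (∫ ω : EuclideanSpace ℝ ι, exp (-U (ω + ψ₀)) • U' (ω + ψ₀) ∂(multivariateGaussian 0 M⁻¹))) (EuclideanSpace.single x (1 :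
          ℝ)) (EuclideanSpace.single y (1 : ℝ)) + ((∫ ω : EuclideanSpace ℝ ι, exp (-U (ω + ψ₀)) ∂(multivariateGaussian 0 M⁻¹))⁻¹ • (∫ ω : EuclideanSpace ℝ ι, exp (-U (ω +
          ψ₀)) • (U'' (ω + ψ₀) - (U' (ω + ψ₀)).smulRight (U' (ω + ψ₀))) ∂(multivariateGaussian 0 M⁻¹)) + (((∫ ω : EuclideanSpace ℝ ι, exp (-U (ω + ψ₀))
          ∂(multivariateGaussian 0 M⁻¹)) ^ 2)⁻¹ • ∫ ω : EuclideanSpace ℝ ι, exp (-U (ω + ψ₀)) • U' (ω + ψ₀) ∂(multivariateGaussian 0 M⁻¹)).smulRight (∫ ω : EuclideanSpace ℝ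
          ι, exp (-U (ω + ψ₀)) • U' (ω + ψ₀) ∂(multivariateGaussian 0 M⁻¹))) (EuclideanSpace.single y (1 : ℝ)) (EuclideanSpace.single x (1 : ℝ))) / 2) *ᵥ (WithLp.ofLp (ζ' -
          ζ)))) ≤ (Λ / 2 + lam) * (∑ x ∈ Y, (ζ' x - ζ x) ^ 2) := by
  have hU'c : Continuous U' := continuous_iff_continuousAt.2 fun φ => (hU'd φ).continuousAt
  obtain ⟨hup, hlo⟩ := block_neg_log_two_sided_at_local hM hfl hΓop Y hUd hU'c hκ₀ hκ₁ ha hτ hδ hθ0 hθ1 hκθ hstab hU'b hwup hlam hUsec hm hUloc ψ₀ ζ ζ'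
  obtain ⟨q1, q2⟩ := block_quadratic_part_two_sided_local hM hfl hΓop Y hUd hU'd hU''c hκ₀ hκ₁ ha hκ₂ hτ hδ hθ0 hθ1 hκθ hstab hU'b hU''b hwup hlam hUsec hm hUloc ψ₀ (ζ' -
      ζ)
  have hinc := quadratic_increment
    (symmMatrix_isHermitian (fun x y : ι => ((∫ ω : EuclideanSpace ℝ ι, exp (-U (ω + ψ₀)) ∂(multivariateGaussian 0 M⁻¹))⁻¹ • (∫ ω : EuclideanSpace ℝ ι, exp (-U (ω + ψ₀)) •
        (U'' (ω + ψ₀) - (U' (ω + ψ₀)).smulRight (U' (ω + ψ₀))) ∂(multivariateGaussian 0 M⁻¹)) + (((∫ ω : EuclideanSpace ℝ ι, exp (-U (ω + ψ₀)) ∂(multivariateGaussian 0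
        M⁻¹)) ^ 2)⁻¹ • ∫ ω : EuclideanSpace ℝ ι, exp (-U (ω + ψ₀)) • U' (ω + ψ₀) ∂(multivariateGaussian 0 M⁻¹)).smulRight (∫ ω : EuclideanSpace ℝ ι, exp (-U (ω + ψ₀)) • U'
        (ω + ψ₀) ∂(multivariateGaussian 0 M⁻¹))) (EuclideanSpace.single x (1 : ℝ)) (EuclideanSpace.single y (1 : ℝ))))
    (WithLp.ofLp ζ) (WithLp.ofLp ζ')
  simp only [WithLp.ofLp_sub, PiLp.sub_apply] at q1 q2 hinc ⊢
  constructor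
  · linarith [hup, hlo, q1, q2, hinc]
  · linarith [hup, hlo, q1, q2, hinc]

end Local

/-! ## §3. Toy -/

/-- Toy (§1): on the empty site set every projected sum vanishes. -/
example (ζ : ι → ℝ) : (∑ i, (fun x : ι => if x ∈ (∅ : Finset ι) then ζ x else 0) i ^ 2) = ∑ x ∈ (∅ : Finset ι), ζ x ^ 2 :=
  sum_sq_proj_univ ∅ ζ

end Summit.QuantumFields.BalabanUV.T4Continuum.NE7b.SupBlockLocalClass
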